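import Literature.MeasureTheory.Group.InvariantQuotientPi
import Literature.MeasureTheory.Group.InvariantQuotientOrbitalProd
import HarnessLib

/-!
# Orbital integrals on a finite product group factor: `∫_{G/C(γ)} Φ(yγy⁻¹) = c Π_i ∫_{G_i/C(γ_i)} ξ_i(a γ_i a⁻¹)`
# for `G ≅ Π G_i`, `γ ↔ (γ_i)` and `Φ = ⊗ ξ_i`
(Gelbart, *Automorphic forms on adele groups* (1975), §10, p. 155, (10.19): the product over the
places of `S`; Folland (1995), Thm. 2.49 for the uniqueness of invariant measures)

Topic `MeasureTheory/Group`; namespace `Literature.MeasureTheory.Group`; theorems only (no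
definition, no named fact, no instance visible to importers). The finite-product analogue of
`InvariantQuotientOrbitalProd` (binary products): for an isomorphism of topological groups
`e : Π_i G_i ≃* G` (`ι` finite) and `γ = e (γ_i)_i`,

* `centralizer_singleton_pi_eq` — `C_{Π G_i}((γ_i)) = Π_i C(γ_i)`; `forall_apply_mem_centralizer_pi_iff`
  — `e p ∈ C(γ) ↔ p ∈ Π_i C(γ_i)` (the compatibility of `cosetCongr e`);
* `descConj_cosetCongr_quotientPiEquiv_symm` — for `Φ(e(a_i)) = Π_i ξ_i(a_i)` the orbital integrand
  pulled back to `Π_i (G_i ⧸ C(γ_i))` is `Π_i ξ_i(a_i γ_i a_i⁻¹)`;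
* `exists_map_cosetCongr_eq_smul_map_symm_pi` — the invariant measure of `G ⧸ C(γ)` in product
  coordinates is `c • (⊠ μ_i)` (`exists_eq_smul_map_symm_pi`);
* `exists_integral_descConj_eq_smul_prod` — **the factorisation**: one `c ≠ 0` with
  `∫_{G/C(γ)} Φ(y γ y⁻¹) dμ = c Π_i ∫_{G_i/C(γ_i)} ξ_i(a γ_i a⁻¹) dμ_i` for all `Φ = ⊗ ξ_i`.

With `G_S = Π_{v ∈ S} G_v` (`GLn.LocalPi`, `Quat.LocalPi`) this turns the `S`-factor of an orbital
integral into the product of the local orbital integrals at the places of `S`, as printed in (10.19).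
Part of the inline (D-0026) decomposition of
`Literature.NumberTheory.Automorphic.strong_multiplicity_one_quaternionUnits`.

## References

* S. Gelbart, *Automorphic forms on adele groups*, Ann. of Math. Studies 83 (1975), §10, p. 155,
  (10.19) [Gelbart1975].
* G. B. Folland, *A Course in Abstract Harmonic Analysis* (1995), §2.6, Thm. 2.49 [Folland1995].
-/

noncomputable section

open MeasureTheory MeasureTheory.Measure Topology
open scoped NNReal ENNReal

namespace Literature.MeasureTheory.Group

/-! ### Centralisers in finite products -/

section Algebra

variable {ι : Type*} {Gi : ι → Type*} [∀ i, Group (Gi i)] {G : Type*} [Group G]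

/-- In a product of groups the centraliser of `(γ_i)` is the product of the centralisers. [folklore] -/
theorem centralizer_singleton_pi_eq (γ : ∀ i, Gi i) :
    Subgroup.centralizer ({γ} : Set (∀ i, Gi i)) = Subgroup.pi Set.univ fun i => Subgroup.centralizer ({γ i} : Set (Gi i)) := by
  ext p
  simp only [Subgroup.mem_centralizer_iff, Set.mem_singleton_iff, forall_eq, Subgroup.mem_pi, Set.mem_univ,
    true_imp_iff]
  exact ⟨fun h i => congrFun h i, fun h => funext h⟩

/-- **`C(γ) = e(Π C(γ_i))`** for `γ = e (γ_i)`: the compatibility hypothesis of `cosetCongr e`.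
[cite: Gelbart1975, p. 155 (10.19)] -/
theorem forall_apply_mem_centralizer_pi_iff (e : (∀ i, Gi i) ≃* G) {γ : G} {γi : ∀ i, Gi i} (hγ : e γi = γ) :
    ∀ p : ∀ i, Gi i, e p ∈ Subgroup.centralizer ({γ} : Set G) ↔
      p ∈ Subgroup.pi Set.univ fun i => Subgroup.centralizer ({γi i} : Set (Gi i)) := by
  intro p
  rw [← centralizer_singleton_pi_eq, ← mulEquiv_apply_mem_centralizer_singleton_iff e, hγ]

/-- **The orbital integrand of a factorizable function in product coordinates**: for
`Φ(e(a_i)) = Π_i ξ_i(a_i)` and `γ = e(γ_i)`, the pull-back of `y C(γ) ↦ Φ(y γ y⁻¹)` along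
`(a_i C(γ_i)) ↦ e(a) C(γ)` is `Π_i ξ_i(a_i γ_i a_i⁻¹)`. [cite: Gelbart1975, p. 155 (10.19)] -/
theorem descConj_cosetCongr_quotientPiEquiv_symm [Fintype ι] {M : Type*} [CommMonoid M] (e : (∀ i, Gi i) ≃* G)
    {γ : G} {γi : ∀ i, Gi i} (hγ : e γi = γ) (Φ : G → M) (ξ : ∀ i, Gi i → M)
    (hΦ : ∀ a : ∀ i, Gi i, Φ (e a) = ∏ i, ξ i (a i))
    (x : ∀ i, Gi i ⧸ Subgroup.centralizer ({γi i} : Set (Gi i))) :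
    descConj γ (Subgroup.centralizer ({γ} : Set G)) (centralizer_comm γ) Φ
        (cosetCongr e _ _ (forall_apply_mem_centralizer_pi_iff e hγ) ((quotientPiEquiv _).symm x)) =
      ∏ i, descConj (γi i) _ (centralizer_comm _) (ξ i) (x i) := by
  -- choose representatives
  have hx : x = fun i => (QuotientGroup.mk (x i).out : Gi i ⧸ Subgroup.centralizer ({γi i} : Set (Gi i))) :=
    funext fun i => (QuotientGroup.out_eq' (x i)).symm
  rw [hx, quotientPiEquiv_symm_mk, cosetCongr_mk, descConj_mk, ← hγ, ← map_mul, ← map_inv, ← map_mul, hΦ]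
  refine Finset.prod_congr rfl fun i _ => ?_
  rw [descConj_mk]
  rfl

end Algebra

/-! ### The invariant measure of `G ⧸ C(γ)` in product coordinates, and the factorisation -/

section Orbital

variable {ι : Type*} [Fintype ι] {Gi : ι → Type*} [∀ i, Group (Gi i)] [∀ i, TopologicalSpace (Gi i)]
  [∀ i, IsTopologicalGroup (Gi i)] [∀ i, LocallyCompactSpace (Gi i)] [∀ i, SecondCountableTopology (Gi i)]
  [∀ i, T2Space (Gi i)]
  {G : Type*} [Group G] [TopologicalSpace G]
  (e : (∀ i, Gi i) ≃* G) (he : Continuous e) (hes : Continuous e.symm) {γ : G} {γi : ∀ i, Gi i} (hγ : e γi = γ)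
  (hC : ∀ i, IsClosed ((Subgroup.centralizer ({γi i} : Set (Gi i)) : Subgroup (Gi i)) : Set (Gi i)))
  [MeasurableSpace (G ⧸ Subgroup.centralizer ({γ} : Set G))] [BorelSpace (G ⧸ Subgroup.centralizer ({γ} : Set G))]
  [∀ i, MeasurableSpace (Gi i ⧸ Subgroup.centralizer ({γi i} : Set (Gi i)))]
  [∀ i, BorelSpace (Gi i ⧸ Subgroup.centralizer ({γi i} : Set (Gi i)))]
  (μ : Measure (G ⧸ Subgroup.centralizer ({γ} : Set G)))
  [SMulInvariantMeasure G (G ⧸ Subgroup.centralizer ({γ} : Set G)) μ] [IsFiniteMeasureOnCompacts μ]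
  (μi : ∀ i, Measure (Gi i ⧸ Subgroup.centralizer ({γi i} : Set (Gi i))))
  [∀ i, SMulInvariantMeasure (Gi i) (Gi i ⧸ Subgroup.centralizer ({γi i} : Set (Gi i))) (μi i)]
  [∀ i, IsFiniteMeasureOnCompacts (μi i)] [∀ i, SigmaFinite (μi i)]

include he hes hγ hC in
/-- **The invariant measure of `G ⧸ C(γ)` in product coordinates**: transported to
`(Π G_i) ⧸ (Π C(γ_i))` along `cosetCongr e⁻¹`, a non-zero invariant `μ` finite on compact sets is
`c • (⊠ μ_i)`, `c ≠ 0`. [cite: Folland1995, Thm. 2.49] [cite: Gelbart1975, p. 155 (10.19)] -/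
theorem exists_map_cosetCongr_eq_smul_map_symm_pi (hμ : μ ≠ 0) (h : ∀ i, μi i ≠ 0)
    [MeasurableSpace ((∀ i, Gi i) ⧸ Subgroup.pi Set.univ fun i => Subgroup.centralizer ({γi i} : Set (Gi i)))]
    [BorelSpace ((∀ i, Gi i) ⧸ Subgroup.pi Set.univ fun i => Subgroup.centralizer ({γi i} : Set (Gi i)))] :
    ∃ c : ℝ≥0, c ≠ 0 ∧
      Measure.map (cosetCongr e.symm (Subgroup.centralizer ({γ} : Set G)) _
          (forall_symm_mem_iff e _ _ (forall_apply_mem_centralizer_pi_iff e hγ))) μ =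
        c • (Measure.pi μi).map (quotientPiHomeomorph _).symm := by
  haveI := smulInvariantMeasure_map_cosetCongr_of_smulInvariant e.symm hes
    (Subgroup.centralizer ({γ} : Set G)) _ (forall_symm_mem_iff e _ _ (forall_apply_mem_centralizer_pi_iff e hγ)) μ
  have hhomeo : Measure.map (cosetCongr e.symm (Subgroup.centralizer ({γ} : Set G)) _
      (forall_symm_mem_iff e _ _ (forall_apply_mem_centralizer_pi_iff e hγ))) μ =
      Measure.map (cosetCongrHomeomorph e _ _ (forall_apply_mem_centralizer_pi_iff e hγ) he hes).symm μ := rfl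
  haveI : IsFiniteMeasureOnCompacts (Measure.map (cosetCongr e.symm (Subgroup.centralizer ({γ} : Set G)) _
      (forall_symm_mem_iff e _ _ (forall_apply_mem_centralizer_pi_iff e hγ))) μ) := by
    rw [hhomeo]
    exact IsFiniteMeasureOnCompacts.map μ _
  have hne : Measure.map (cosetCongr e.symm (Subgroup.centralizer ({γ} : Set G)) _
      (forall_symm_mem_iff e _ _ (forall_apply_mem_centralizer_pi_iff e hγ))) μ ≠ 0 := by
    rw [hhomeo, Ne, Measure.map_eq_zero_iff (Homeomorph.measurable _).aemeasurable]
    exact hμ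
  exact exists_eq_smul_map_symm_pi _ hC μi h _ hne

include he hes hγ hC in
/-- **Orbital integrals of factorizable functions on a finite product factor** (Gelbart (1975),
p. 155, (10.19): `Π_{v ∈ S} ∫_{B_v \ G_v} f_v(x_v⁻¹ γ x_v) dx_v`). For a bicontinuous
`e : Π_i G_i ≃* G`, `γ = e(γ_i)` with closed centralisers `C(γ_i)`, and non-zero invariant measures
`μ` on `G ⧸ C(γ)`, `μ_i` on `G_i ⧸ C(γ_i)` finite on compact sets, there is ONE `c ≠ 0` such that for
all complex `Φ`, `ξ_i` with `Φ(e(a_i)) = Π_i ξ_i(a_i)`: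
`∫_{G/C(γ)} Φ(y γ y⁻¹) dμ(y) = c Π_i ∫_{G_i/C(γ_i)} ξ_i(a γ_i a⁻¹) dμ_i(a)`.
[cite: Gelbart1975, p. 155 (10.19)] -/
theorem exists_integral_descConj_eq_smul_prod (hμ : μ ≠ 0) (h : ∀ i, μi i ≠ 0) :
    ∃ c : ℝ≥0, c ≠ 0 ∧ ∀ (Φ : G → ℂ) (ξ : ∀ i, Gi i → ℂ),
      (∀ a : ∀ i, Gi i, Φ (e a) = ∏ i, ξ i (a i)) →
        ∫ y, descConj γ (Subgroup.centralizer ({γ} : Set G)) (centralizer_comm γ) Φ y ∂μ =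
          c • ∏ i, ∫ x, descConj (γi i) _ (centralizer_comm _) (ξ i) x ∂(μi i) := by
  letI : MeasurableSpace ((∀ i, Gi i) ⧸ Subgroup.pi Set.univ fun i => Subgroup.centralizer ({γi i} : Set (Gi i))) :=
    borel _
  haveI : BorelSpace ((∀ i, Gi i) ⧸ Subgroup.pi Set.univ fun i => Subgroup.centralizer ({γi i} : Set (Gi i))) := ⟨rfl⟩
  haveI : ∀ i, SecondCountableTopology (Gi i ⧸ Subgroup.centralizer ({γi i} : Set (Gi i))) := fun i => inferInstance
  obtain ⟨c, hc0, hc⟩ := exists_map_cosetCongr_eq_smul_map_symm_pi e he hes hγ hC μ μi hμ h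
  refine ⟨c, hc0, fun Φ ξ hΦ => ?_⟩
  set F := descConj γ (Subgroup.centralizer ({γ} : Set G)) (centralizer_comm γ) Φ with hF
  set ψ := cosetCongrHomeomorph e _ _ (forall_apply_mem_centralizer_pi_iff e hγ) he hes with hψ
  have h1 : ∫ y, F y ∂μ = ∫ z, F (ψ z) ∂(Measure.map ψ.symm μ) := by
    rw [← Homeomorph.toMeasurableEquiv_coe ψ.symm, integral_map_equiv]
    simp only [Homeomorph.toMeasurableEquiv_coe, Homeomorph.apply_symm_apply]
  have hmap : Measure.map ψ.symm μ = c • (Measure.pi μi).map (quotientPiHomeomorph _).symm := hc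
  rw [h1, integral_eq_smul_prod_integral _ μi hmap (fun z => F (ψ z)) (fun i => descConj (γi i) _ (centralizer_comm _) (ξ i))]
  intro p
  exact descConj_cosetCongr_quotientPiEquiv_symm e hγ Φ ξ hΦ p

end Orbital

end Literature.MeasureTheory.Group
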